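import Mathlib
import Summits.KontsevichZagierPeriods.Zeta5Search.Families.CellularBrownZudilinGrowth
import HarnessLib

/-!
# ζ(5) search — Families: transport certificates for growth constants — `M_σ^q · q^{q(ℓ+1)} ≤ ∏ p^p`

HONEST FRAMING: systematic search; no irrationality claim unless certified.  STRUCTURAL facts about the size of Brown's
basic cellular integrals `I_σ(N) = ∫ f_σ^N ω_σ` [Brown2016, §1.5 (1.3)–(1.4)] (seat P2, Families layer); nothing about the
arithmetic of any zeta value.

`Families/BasicGrowthHalfPow.lean` bounds every growth constant `M_σ = sup f_σ` by `2^{−(n−2)}`.  The same mechanism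
gives ARBITRARILY SHARP certified upper bounds from explicit integer data:

* **`fSigma_pow_mul_le_of_transport`**, **`fSup_pow_mul_le_of_transport`** — let `p : positions × gaps → ℕ` be an
  INTEGER TRANSPORT PLAN of weight `q ≥ 1`: `p(i,w) = 0` unless the `σδ⁰`-edge at position `i` is finite and spans the
  gap `w`, every finite edge has row sum `q`, every gap has column sum `q`.  Then
  **`M_σ^q · q^{q(ℓ+1)} ≤ ∏_{i,w} p(i,w)^{p(i,w)}`** (weighted AM–GM on every edge: `len_e^q · ∏_w p^p ≥ q^q ∏_w g_w^{p}`,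
  `pow_mul_prod_pow_le`).  The case `q = 2`, `p ∈ {0,1}` is the two-matching bound of `Families/BasicGrowthTwoFactor.lean`.
* By convex (geometric-programming / matrix-scaling) duality the best such bound is TIGHT: `1/M_σ` is the CAPACITY
  `inf_{g>0} ∏_e (Σ_{w∈e} g_w)/∏_w g_w` of the `0/1` edge–gap interval matrix, `= exp(max H(B))` over doubly stochastic `B`
  supported on the spans, attained at the Sinkhorn scaling — NOT asserted here (numerics: `HOME/pub-zeta5-p2/g4/cert8.py`
  reproduces `φ^{-5}`, `(√2−1)^4`, `0.0050038` for `₅π`, Brown's `N = 6`, `₈π₈^∨`); what IS proved is that every integer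
  plan certifies an upper bound and every rational point of the simplex a lower bound (`fSigma_le_fSup`), so each `M_σ`
  is enclosed by kernel arithmetic alone.
* **`bzSup_one_enclosure`** — for the Brown–Zudilin configuration `₈π₈^∨` on its basic ray:
  **`0.005003 ≤ M_{₈π₈^∨} ≤ 0.00502`** (lower: the rational point with gaps `(315,100,46,78,145,316)/1000`; upper: a
  weight-`50` plan rounded from the Sinkhorn scaling), i.e. the decay base `|λ₂| = 0.0050038…` of [BrownZudilin2022, §2]
  for the basic family `I(n·(1,…,1))`, certified to three digits WITHOUT any recurrence (the tree had `≤ 1/64`).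
Standard axioms only.
-/

noncomputable section

open MeasureTheory Set Finset Filter Topology

namespace Summit.KontsevichZagierPeriods.Zeta5Search.Families.Cellular

open Literature.NumberTheory.Irrationality

variable {ℓ : ℕ} (σ : Fin (ℓ + 3) → Fin (ℓ + 3))

/-! ### Integer-weight AM–GM -/

/-- **Integer-weight AM–GM**: for `k_i ≥ 1` with `q = Σ_i k_i` and `g_i ≥ 0`,
`q^q · ∏_i g_i^{k_i} ≤ (Σ_i g_i)^q · ∏_i k_i^{k_i}`. -/
theorem pow_mul_prod_pow_le {ι : Type*} (s : Finset ι) (k : ι → ℕ) (g : ι → ℝ) (hk : ∀ i ∈ s, 0 < k i)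
    (hg : ∀ i ∈ s, 0 ≤ g i) (hs : s.Nonempty) :
    ((∑ i ∈ s, k i : ℕ) : ℝ) ^ (∑ i ∈ s, k i) * ∏ i ∈ s, g i ^ k i ≤
      (∑ i ∈ s, g i) ^ (∑ i ∈ s, k i) * ∏ i ∈ s, (k i : ℝ) ^ k i := by
  set q := ∑ i ∈ s, k i with hq
  have hqpos : 0 < q := Finset.sum_pos hk hs
  have hqR : (0 : ℝ) < q := by exact_mod_cast hqpos
  -- AM–GM with weights `k_i/q` at the points `q g_i / k_i`
  have hw : ∀ i ∈ s, (0 : ℝ) ≤ (k i : ℝ) / q := fun i _ => by positivity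
  have hw' : ∑ i ∈ s, ((k i : ℝ) / q) = 1 := by
    rw [← Finset.sum_div, div_eq_one_iff_eq hqR.ne', hq, Nat.cast_sum]
  have hz : ∀ i ∈ s, (0 : ℝ) ≤ (q : ℝ) * g i / k i := fun i hi => by have := hg i hi; positivity
  have amgm := Real.geom_mean_le_arith_mean_weighted s (fun i => (k i : ℝ) / q)
    (fun i => (q : ℝ) * g i / k i) hw hw' hz
  have hR : ∑ i ∈ s, (k i : ℝ) / q * ((q : ℝ) * g i / k i) = ∑ i ∈ s, g i := by
    refine Finset.sum_congr rfl fun i hi => ?_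
    have hki : (k i : ℝ) ≠ 0 := by exact_mod_cast (hk i hi).ne'
    field_simp
  rw [hR] at amgm
  -- raise to the `q`-th power
  have hL0 : 0 ≤ ∏ i ∈ s, ((q : ℝ) * g i / k i) ^ ((k i : ℝ) / q) :=
    Finset.prod_nonneg fun i hi => Real.rpow_nonneg (hz i hi) _
  have hpow := pow_le_pow_left₀ hL0 amgm q
  have hL : (∏ i ∈ s, ((q : ℝ) * g i / k i) ^ ((k i : ℝ) / q)) ^ q =
      ∏ i ∈ s, ((q : ℝ) * g i / k i) ^ k i := by
    rw [← Finset.prod_pow]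
    refine Finset.prod_congr rfl fun i hi => ?_
    rw [← Real.rpow_natCast, ← Real.rpow_mul (hz i hi), div_mul_cancel₀ _ hqR.ne', Real.rpow_natCast]
  rw [hL] at hpow
  have hkpos : 0 < ∏ i ∈ s, (k i : ℝ) ^ k i :=
    Finset.prod_pos fun i hi => pow_pos (by exact_mod_cast hk i hi) _
  have hsplit : ∏ i ∈ s, ((q : ℝ) * g i / k i) ^ k i =
      (q : ℝ) ^ q * (∏ i ∈ s, g i ^ k i) / ∏ i ∈ s, (k i : ℝ) ^ k i := by
    rw [eq_div_iff hkpos.ne', hq, ← Finset.prod_pow_eq_pow_sum, ← Finset.prod_mul_distrib,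
      ← Finset.prod_mul_distrib]
    refine Finset.prod_congr rfl fun i hi => ?_
    have hki : (k i : ℝ) ≠ 0 := by exact_mod_cast (hk i hi).ne'
    rw [div_pow, mul_pow, div_mul_cancel₀ _ (pow_ne_zero _ hki)]
  rw [hsplit, div_le_iff₀ hkpos] at hpow
  exact hpow

/-! ### Transport certificates -/

/-- **Transport certificate, pointwise.**  For a bijective seating `σ` and an integer transport plan `p` of weight
`q ≥ 1` between the positions of the finite `σδ⁰`-edges and the gaps they span (row sums `q` on finite edges, column
sums `q`, support inside the spans): `f_σ(t)^q · q^{q(ℓ+1)} ≤ ∏_{i,w} p(i,w)^{p(i,w)}` on the open simplex. -/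
theorem fSigma_pow_mul_le_of_transport (hσ : Function.Bijective σ) {q : ℕ} (hq : 0 < q)
    (p : Fin (ℓ + 3) → Fin (ℓ + 1) → ℕ)
    (hsupp : ∀ i w, p i w ≠ 0 → ((σ i).val ≠ ℓ + 2 ∧ (σ (i + 1)).val ≠ ℓ + 2) ∧
      min (σ i).val (σ (i + 1)).val ≤ w.val ∧ w.val < max (σ i).val (σ (i + 1)).val)
    (hrow : ∀ i, ((σ i).val ≠ ℓ + 2 ∧ (σ (i + 1)).val ≠ ℓ + 2) → ∑ w, p i w = q)
    (hcol : ∀ w, ∑ i, p i w = q) {t : Fin ℓ → ℝ} (ht : t ∈ openSimplex ℓ) :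
    fSigma σ t ^ q * (q : ℝ) ^ (q * (ℓ + 1)) ≤ ∏ i, ∏ w, (p i w : ℝ) ^ p i w := by
  classical
  have hpos := (mem_openSimplex_iff_gapN t).1 ht
  set L : Fin (ℓ + 3) → ℝ := fun i => ef t (σ i) (σ (i + 1)) with hL
  have hLpos : ∀ i, 0 < L i := fun i => ef_pos ht fun h => succ_ne_self i (hσ.1 h)
  have hden : formDen σ t = ∏ i, L i := rfl
  have hrow0 : ∀ i, ¬ ((σ i).val ≠ ℓ + 2 ∧ (σ (i + 1)).val ≠ ℓ + 2) → ∀ w, p i w = 0 := fun i hi w => by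
    by_contra h
    exact hi (hsupp i w h).1
  -- per position: `q^{row} ∏_w g_w^{p} ≤ L_i^q ∏_w p^p`
  have hstep : ∀ i, (q : ℝ) ^ (∑ w, p i w) * ∏ w : Fin (ℓ + 1), gapN t w ^ p i w ≤
      L i ^ q * ∏ w, (p i w : ℝ) ^ p i w := by
    intro i
    by_cases hfin : (σ i).val ≠ ℓ + 2 ∧ (σ (i + 1)).val ≠ ℓ + 2
    · rw [hrow i hfin]
      set s := univ.filter fun w : Fin (ℓ + 1) => p i w ≠ 0 with hs
      have hmem : ∀ w, w ∈ s ↔ p i w ≠ 0 := fun w => by simp [hs]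
      rcases s.eq_empty_or_nonempty with hse | hsne
      · exfalso
        have h0 : ∑ w, p i w = 0 := Finset.sum_eq_zero fun w _ => by
          by_contra h
          have : w ∈ s := (hmem w).2 h
          rw [hse] at this
          exact Finset.notMem_empty w this
        rw [hrow i hfin] at h0
        omega
      have hks : ∀ w ∈ s, 0 < p i w := fun w hw => Nat.pos_of_ne_zero ((hmem w).1 hw)
      have hsum_s : ∑ w ∈ s, p i w = q := by
        rw [← hrow i hfin, hs, Finset.sum_filter_ne_zero]
      have key := pow_mul_prod_pow_le s (p i) (fun w => gapN t w) hks (fun w _ => (hpos w).le) hsne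
      rw [hsum_s] at key
      have h1 : ∏ w ∈ s, gapN t w ^ p i w = ∏ w : Fin (ℓ + 1), gapN t w ^ p i w := by
        refine Finset.prod_subset (Finset.filter_subset _ _) fun w _ hw => ?_
        have : p i w = 0 := by by_contra h; exact hw ((hmem w).2 h)
        rw [this, pow_zero]
      have h2 : ∏ w ∈ s, (p i w : ℝ) ^ p i w = ∏ w, (p i w : ℝ) ^ p i w := by
        refine Finset.prod_subset (Finset.filter_subset _ _) fun w _ hw => ?_
        have : p i w = 0 := by by_contra h; exact hw ((hmem w).2 h)
        rw [this, pow_zero]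
      rw [h1, h2] at key
      -- the supported gaps lie in the span, so their sum is at most the edge length
      have h3 : ∑ w ∈ s, gapN t w ≤ L i := by
        have hlen : L i = (cellEdges σ hσ.1).len t (Sum.inr ⟨i, hfin⟩) := by
          simp only [hL, ef_sigma_of_finite σ t i hfin]
          rfl
        rw [hlen, (cellEdges σ hσ.1).len_eq_sum_gap]
        refine Finset.sum_le_sum_of_subset_of_nonneg (fun w hw => ?_) fun w _ _ => (hpos w).le
        have hw' : p i w ≠ 0 := (hmem w).1 hw
        rw [EdgeFamily.mem_span]
        simp only [cellEdges, Sum.elim_inr]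
        exact (hsupp i w hw').2
      calc (q : ℝ) ^ q * ∏ w : Fin (ℓ + 1), gapN t w ^ p i w
          ≤ (∑ w ∈ s, gapN t w) ^ q * ∏ w, (p i w : ℝ) ^ p i w := key
        _ ≤ L i ^ q * ∏ w, (p i w : ℝ) ^ p i w :=
          mul_le_mul_of_nonneg_right
            (pow_le_pow_left₀ (Finset.sum_nonneg fun w _ => (hpos w).le) h3 q)
            (Finset.prod_nonneg fun w _ => pow_nonneg (Nat.cast_nonneg _) _)
    · have h0 := hrow0 i hfin
      have hLi : L i = 1 := by
        simp only [hL]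
        exact ef_sigma_of_infinite σ t i hfin
      simp [h0, hLi]
  -- multiply over the positions
  have hprod := Finset.prod_le_prod (s := (univ : Finset (Fin (ℓ + 3))))
    (fun i _ => mul_nonneg (pow_nonneg (Nat.cast_nonneg _) _) (Finset.prod_nonneg fun w _ => pow_nonneg (hpos w).le _))
    fun i _ => hstep i
  rw [Finset.prod_mul_distrib, Finset.prod_mul_distrib, Finset.prod_pow_eq_pow_sum, Finset.prod_pow] at hprod
  have htot : ∑ i, ∑ w, p i w = q * (ℓ + 1) := by
    rw [Finset.sum_comm]
    simp only [hcol, Finset.sum_const, Finset.card_univ, Fintype.card_fin, smul_eq_mul]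
    ring
  have hnum : ∏ i, ∏ w : Fin (ℓ + 1), gapN t w ^ p i w = (∏ w : Fin (ℓ + 1), gapN t w) ^ q := by
    rw [Finset.prod_comm, ← Finset.prod_pow]
    refine Finset.prod_congr rfl fun w _ => ?_
    rw [Finset.prod_pow_eq_pow_sum, hcol]
  rw [htot, hnum] at hprod
  have hLq : 0 < (∏ i, L i) ^ q := pow_pos (Finset.prod_pos fun i _ => hLpos i) _
  unfold fSigma
  rw [prod_ef_succ_eq_prod_gapN, hden, div_pow, div_mul_eq_mul_div, div_le_iff₀ hLq]
  calc (∏ w : Fin (ℓ + 1), gapN t w) ^ q * (q : ℝ) ^ (q * (ℓ + 1))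
        = (q : ℝ) ^ (q * (ℓ + 1)) * (∏ w : Fin (ℓ + 1), gapN t w) ^ q := mul_comm _ _
    _ ≤ (∏ i, L i) ^ q * ∏ i, ∏ w, (p i w : ℝ) ^ p i w := hprod
    _ = (∏ i, ∏ w, (p i w : ℝ) ^ p i w) * (∏ i, L i) ^ q := mul_comm _ _

/-- **Transport certificate for the growth constant**: under the hypotheses of `fSigma_pow_mul_le_of_transport`,
`M_σ^q · q^{q(ℓ+1)} ≤ ∏_{i,w} p(i,w)^{p(i,w)}`. -/
theorem fSup_pow_mul_le_of_transport (hσ : Function.Bijective σ) {q : ℕ} (hq : 0 < q)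
    (p : Fin (ℓ + 3) → Fin (ℓ + 1) → ℕ)
    (hsupp : ∀ i w, p i w ≠ 0 → ((σ i).val ≠ ℓ + 2 ∧ (σ (i + 1)).val ≠ ℓ + 2) ∧
      min (σ i).val (σ (i + 1)).val ≤ w.val ∧ w.val < max (σ i).val (σ (i + 1)).val)
    (hrow : ∀ i, ((σ i).val ≠ ℓ + 2 ∧ (σ (i + 1)).val ≠ ℓ + 2) → ∑ w, p i w = q)
    (hcol : ∀ w, ∑ i, p i w = q) :
    fSup σ ^ q * (q : ℝ) ^ (q * (ℓ + 1)) ≤ ∏ i, ∏ w, (p i w : ℝ) ^ p i w := by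
  set P : ℝ := ∏ i, ∏ w, (p i w : ℝ) ^ p i w with hP
  have hQ : (0 : ℝ) < (q : ℝ) ^ (q * (ℓ + 1)) := pow_pos (by exact_mod_cast hq) _
  have hP0 : 0 ≤ P := Finset.prod_nonneg fun i _ => Finset.prod_nonneg fun w _ => pow_nonneg (Nat.cast_nonneg _) _
  -- `f ≤ (P / q^{q(ℓ+1)})^{1/q}` pointwise, hence for the supremum
  set K : ℝ := (P / (q : ℝ) ^ (q * (ℓ + 1))) ^ ((q : ℝ)⁻¹) with hK
  have hK0 : 0 ≤ K := Real.rpow_nonneg (div_nonneg hP0 hQ.le) _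
  have hKq : K ^ q = P / (q : ℝ) ^ (q * (ℓ + 1)) := by
    rw [hK]
    exact Real.rpow_inv_natCast_pow (div_nonneg hP0 hQ.le) hq.ne'
  have hpt : ∀ t ∈ openSimplex ℓ, fSigma σ t ≤ K := by
    intro t ht
    have h := fSigma_pow_mul_le_of_transport σ hσ hq p hsupp hrow hcol ht
    rw [← le_div_iff₀ hQ, ← hKq] at h
    exact le_of_pow_le_pow_left₀ hq.ne' hK0 h
  have hsup : fSup σ ≤ K := fSup_le_of_forall_le σ hpt
  have := pow_le_pow_left₀ (fSup_pos σ hσ).le hsup q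
  rw [hKq, le_div_iff₀ hQ] at this
  exact this

/-! ### The Brown–Zudilin basic family: `0.005003 ≤ M_{₈π₈^∨} ≤ 0.00502` -/

/-- A weight-`50` integer transport plan for `₈π₈^∨ = ![7,1,3,0,6,4,2,5]` (positions `0` and `7` carry the edges
through `∞`), rounded from the Sinkhorn scaling of the edge–gap interval matrix. -/
def bzPlan : Fin 8 → Fin 6 → ℕ :=
  ![![0, 0, 0, 0, 0, 0], ![0, 34, 16, 0, 0, 0], ![34, 11, 5, 0, 0, 0], ![16, 5, 2, 4, 7, 16], ![0, 0, 0, 0, 16, 34],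
    ![0, 0, 18, 32, 0, 0], ![0, 0, 9, 14, 27, 0], ![0, 0, 0, 0, 0, 0]]

/-- `M_{₈π₈^∨}^{50} · 50^{300} ≤ ∏ p^p` for the plan `bzPlan`. -/
theorem fSup_pi8dual_pow_le :
    fSup pi8dual ^ 50 * (50 : ℝ) ^ (50 * (5 + 1)) ≤ ∏ i, ∏ w, (bzPlan i w : ℝ) ^ bzPlan i w :=
  fSup_pow_mul_le_of_transport pi8dual pi8dual_bijective (by norm_num) bzPlan (by decide) (by decide) (by decide)

/-- The certificate product `∏ p^p` of `bzPlan`, evaluated by the kernel (a 395-digit integer). -/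
theorem bzPlan_prod : (∏ i, ∏ w, bzPlan i w ^ bzPlan i w : ℕ) =
    48532801363762955853850097226225610008920059569297141170346213812591796420754239693387535534511200461031406722008646464767209176063646775303393969874311641906970893001008530438905159915464636181631849733561801191291951285603857708334076760134089843542831257081191407911452693412768953907998441382518528197611309972694567122805751079136106589477848731439369138686269114010988509701079040000000000 := by
  decide

set_option exponentiation.threshold 512 in
/-- **`M_{₈π₈^∨} ≤ 0.00502`** (Brown–Zudilin basic ray; the tree's previous bound was `1/64 = 0.0156`). -/
theorem fSup_pi8dual_le_cert : fSup pi8dual ≤ 502 / 100000 := by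
  have h := fSup_pi8dual_pow_le
  have hcast : (∏ i, ∏ w, (bzPlan i w : ℝ) ^ bzPlan i w) = ((∏ i, ∏ w, bzPlan i w ^ bzPlan i w : ℕ) : ℝ) := by
    push_cast
    rfl
  rw [hcast, bzPlan_prod] at h
  have hP : ((48532801363762955853850097226225610008920059569297141170346213812591796420754239693387535534511200461031406722008646464767209176063646775303393969874311641906970893001008530438905159915464636181631849733561801191291951285603857708334076760134089843542831257081191407911452693412768953907998441382518528197611309972694567122805751079136106589477848731439369138686269114010988509701079040000000000 : ℕ) : ℝ) ≤
      (502 / 100000 : ℝ) ^ 50 * (50 : ℝ) ^ (50 * (5 + 1)) := by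
    norm_num
  have h2 : fSup pi8dual ^ 50 ≤ (502 / 100000 : ℝ) ^ 50 :=
    le_of_mul_le_mul_right (h.trans hP) (by positivity)
  exact le_of_pow_le_pow_left₀ (by norm_num) (by norm_num) h2

/-- The rational point with gaps `(315, 100, 46, 78, 145, 316)/1000`, near the maximiser of `f_{₈π₈^∨}`. -/
def bzPoint : Fin 5 → ℝ := ![315 / 1000, 415 / 1000, 461 / 1000, 539 / 1000, 684 / 1000]

/-- `bzPoint` lies in the open simplex. -/
theorem bzPoint_mem : bzPoint ∈ openSimplex 5 := by
  simp [openSimplex, Fin.forall_fin_succ, pt, bzPoint]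
  norm_num

/-- `f_{₈π₈^∨}` in simplicial coordinates. [BrownZudilin2022, §2 objects] -/
theorem fSigma_pi8dual (t : Fin 5 → ℝ) :
    fSigma pi8dual t = t 0 * (t 1 - t 0) * (t 2 - t 1) * (t 3 - t 2) * (t 4 - t 3) * (1 - t 4) /
      ((t 2 - t 0) * t 2 * 1 * (1 - t 3) * (t 3 - t 1) * (t 4 - t 1)) := by
  simp [fSigma, formDen, Fin.prod_univ_eight, pi8dual, ef, pt, max_def, min_def]

/-- **`0.005003 ≤ M_{₈π₈^∨}`** from the value of `f` at `bzPoint`. -/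
theorem le_fSup_pi8dual_cert : 5003 / 1000000 ≤ fSup pi8dual := by
  have h := fSigma_le_fSup pi8dual pi8dual_bijective bzPoint_mem
  have hval : (5003 / 1000000 : ℝ) ≤ fSigma pi8dual bzPoint := by
    have e0 : bzPoint 0 = 315 / 1000 := rfl
    have e1 : bzPoint 1 = 415 / 1000 := rfl
    have e2 : bzPoint 2 = 461 / 1000 := rfl
    have e3 : bzPoint 3 = 539 / 1000 := rfl
    have e4 : bzPoint 4 = 684 / 1000 := rfl
    rw [fSigma_pi8dual, e0, e1, e2, e3, e4]
    norm_num
  exact hval.trans h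

/-- **The decay base of the Brown–Zudilin basic family, enclosed: `0.005003 ≤ bzSup(1,…,1) = M_{₈π₈^∨} ≤ 0.00502`**
(numerically `0.0050038 = |λ₂|` of [BrownZudilin2022, §2]); with `tendsto_cellularIntegral_root`,
`lim I(n,…,n)^{1/n} ∈ [0.005003, 0.00502]`. -/
theorem bzSup_one_enclosure :
    5003 / 1000000 ≤ bzSup (fun _ => (1 : ℤ)) ∧ bzSup (fun _ => (1 : ℤ)) ≤ 502 / 100000 := by
  rw [bzSup_one]
  exact ⟨le_fSup_pi8dual_cert, fSup_pi8dual_le_cert⟩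

/-- Hence `I(n,…,n) ≤ 0.00502^n · I(0,…,0)` for the Brown–Zudilin totally symmetric integrals. -/
theorem cellularIntegral_symmetric_le_cert (n : ℕ) :
    BrownZudilin2022.cellularIntegral (fun _ => (n : ℤ)) ≤
      (502 / 100000 : ℝ) ^ n * BrownZudilin2022.cellularIntegral (fun _ => (0 : ℤ)) := by
  have h := (integral_basic_le_fSup_pow pi8dual pi8dual_bijective n).trans
    (mul_le_mul_of_nonneg_right
      (pow_le_pow_left₀ (fSup_pos pi8dual pi8dual_bijective).le fSup_pi8dual_le_cert n)
      (integral_nonneg pi8dual_bijective.1 _ _))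
  rwa [integral_bz_symmetric, integral_bz_symmetric] at h

end Summit.KontsevichZagierPeriods.Zeta5Search.Families.Cellular
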